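import Mathlib
import HarnessLib
import HarnessLib.Audit
import Summits.PneNP.Statement
import Literature.Computability.Complexity.KRWComposition
import Literature.Computability.Complexity.ConstantDepth
import Literature.Computability.Complexity.Classes
import HarnessLib.Audit.Status.Attr

/-!
Route: KrwChromaticSteering

# Route KrwChromaticSteering — Weak KRW from strong composition with gamma one by chromatic
steering, plus Meir's first obstacle

It suffices to show X = C1 ∧ C2 ∧ S3 ∧ R over the tree's Karchmer–Wigderson protocol trees
(`KWTree`, matrices `Fin m × Fin n → Bool`,
`blockComp f g` = f ⋄ g, `SolvesStrong` = the strong composition game KW_f ⊛ KW_g of Meir 2023): C1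
(STRONG COMPOSITION WITH γ = 1, the
deciding crux): for every non-constant f on m bits and n ≥ 1 some g on n bits makes every tree for
KW_f ⊛ KW_g at least depth(Q) + n −
c·(log₂(mn)+1) deep for some tree Q solving KW_f; C2 (MEIR'S FIRST OBSTACLE, hardest-inner-function
form): some g₀ makes KW_{f⋄g₀} as hard,
up to c·(log₂(mn)+1), as KW_f ⊛ KW_g for every g; S3 (support, in print): the weak KRW conjecture in
this depth form gives L ∈ P outside
non-uniform NC¹; R (declared RESIDUAL, S-implied): P ⊄ NC¹ → P ≠ NP. Card realised:
krw-chromatic-steering (spine; markdown-first sketch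
PASSED 2026-08-17). C1 ∧ C2 give weak KRW by a four-line composition (`weakKRW_of` in glue.lean); S3
and R carry it to `PneNP`.
Lean: `(∃ c : ℕ, ∀ m n : ℕ, 1 ≤ n → ∀ f : (Fin m → Bool) → Bool, (∃ a b, f a ≠ f b) → ∃ g : (Fin n →
Bool) → Bool, ∀ P : Literature.Computability.Complexity.KWTree (Fin m × Fin n), P.SolvesStrong f g →
∃ Q : Literature.Computability.Complexity.KWTree (Fin m), Q.Solves f ∧ Q.depth + n ≤ P.depth + c *
(Nat.log 2 (m * n) + 1)) ∧ (∃ c : ℕ, ∀ m n : ℕ, 1 ≤ n → ∀ f : (Fin m → Bool) → Bool, (∃ a b, f a ≠ f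
b) → ∃ g₀ : (Fin n → Bool) → Bool, ∀ g : (Fin n → Bool) → Bool, ∀ P :
Literature.Computability.Complexity.KWTree (Fin m × Fin n), P.Solves
(Literature.Computability.Complexity.blockComp f g₀) → ∃ P' :
Literature.Computability.Complexity.KWTree (Fin m × Fin n), P'.SolvesStrong f g ∧ P'.depth ≤ P.depth
+ c * (Nat.log 2 (m * n) + 1)) ∧ ((∃ c : ℕ, ∀ m n : ℕ, 1 ≤ n → ∀ f : (Fin m → Bool) → Bool, (∃ a b,
f a ≠ f b) → ∃ g : (Fin n → Bool) → Bool, ∀ P : Literature.Computability.Complexity.KWTree (Fin m ×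
Fin n), P.Solves (Literature.Computability.Complexity.blockComp f g) → ∃ Q :
Literature.Computability.Complexity.KWTree (Fin m), Q.Solves f ∧ Q.depth + n ≤ P.depth + c *
(Nat.log 2 (m * n) + 1)) → ∃ L ∈ Literature.Computability.Complexity.Classes.P, L ∉
Literature.Computability.Complexity.NC1) ∧ (¬ (Literature.Computability.Complexity.Classes.P ⊆
Literature.Computability.Complexity.NC1) → PneNP)`

## Assembly
Pure logic, kernel-checked in glue.lean: `weakKRW_of : StrongComposition → StandardFromStrong → weak
KRW` (take the g₀ of C2; a KW_{f⋄g₀}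
tree gives a KW_f ⊛ KW_g tree for the g of C1 at cost c₂·L, which gives a KW_f tree shorter by n at
cost c₁·L, L = ⌊log₂(mn)⌋+1), then
`closes h1 h2 s3 hR : PneNP := hR (fun hsub => let ⟨L, hLP, hLNC⟩ := s3 (weakKRW_of h1 h2); hLNC
(hsub hLP))`. All four binders are
consumed (cone = 4); the Assembly item below is inhabited by `closes` (`assembly_holds` in
glue.lean).

Rationale: WHY THIS LINE. Meir 2023 (Meir2023, arXiv:2306.00615, Thm 1.1/3.1) proved strong composition only up
to a loss (1−γ)·m with γ ≈ 0.04, by AVERAGING over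
inner functions along a transcript, and showed (§7 Prop 9) that the averaged/"live-transcript"
argument cannot pass γ = 0.64; the card's
mechanism replaces averaging by STEERING the transcript with the potential |π| + (restricted KW_f
complexity of the live label rectangle)
+ log log χ(G_π) of Meir's characteristic graph — χ is sub-multiplicative under the one-bit split of
a transcript and restricted protocol
depth is one-bit sub-additive, so a steered walk can refuse to pay the (1−γ)·m. C1 is exactly
"Meir's theorem with γ = 1"; C2 is the other
half of the KRW programme that Meir isolates as "the crucial barrier" (the first obstacle: a
standard protocol may answer in a row whose
labels agree), typed in its weakest closing form (hardest inner function vs hardest inner function,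
= CC^phd(KW_f ⊛ MUX) ≤ CC^phd(KW_f ⋄
MUX) + O(log) by Meir's Lemma 6). Imported area: two-party communication complexity in the partially
half-duplex model (HIMS18, MS21) and
graph colouring (chromatic number of characteristic graphs, co-nondeterministic graph inequality);
the glue to the summit is the classical
KRW95 §5 iteration (S3) and the honest residual R. No existing PneNP route touches KW games or
composition (cone check over 59 Theses: no
`KWTree`, `KRW`, `Karchmer` in any Theses file); the negatives index (6 entries) has nothing on
protocols.

RANKED CRUXES. #2 StrongComposition (crux) — Strong composition with γ = 1 (card item C1): ∃ c ∀ m n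
≥ 1 ∀ non-constant f : {0,1}^m → {0,1} ∃ g : {0,1}^n → {0,1} ∀ protocol tree P solving KW_f ⊛ KW_g ∃
tree Q solving KW_f with depth Q + n ≤ depth P + c·(⌊log₂(mn)⌋+1). [difficulty: XL] (why it might
fail: Meir §7 Prop 9: for L(f) ≥ 2^m/m, m ≥ 2n there is a protocol and a 0.64-live transcript with
χ(G_π) = 1; if such transcripts can ALSO keep every live residual label rectangle cheap, no steering
potential survives and γ = 1 is false for depth as typed.) [Meir2023, arXiv:2306.00615,
KarchmerRazWigderson1995, DinurMeir2016]
#3 StandardFromStrong (crux) — Meir's first obstacle, hardest-inner-function form (card item C2): ∃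
c ∀ m, n ≥ 1 ∀ non-constant f ∃ g₀ ∀ g ∀ tree P solving KW_{f ⋄ g₀} ∃ tree P' solving KW_f ⊛ KW_g
with depth P' ≤ depth P + c·(⌊log₂(mn)⌋+1); equivalently max_g C(KW_f ⊛ KW_g) ≤ max_g C(KW_f ⋄ KW_g)
+ O(log mn), i.e. CC^phd(KW_f ⊛ MUX_n) ≤ CC^phd(KW_f ⋄ MUX_n) + O(log mn). [difficulty: XL] (why it
might fail: rows with a_i = b_i "might contain solutions as well" (dRMNPR20 p.5): a Sipser ⊕₃⋄⊕₃ /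
Pudlák T²ₙ-type saving that locates a differing entry in an equal-label row by hashing could grow to
ω(log mn) at the ⋄-hardest g₀, refuting the comparison as typed.) [Meir2023, arXiv:2306.00615,
arXiv:2007.02740, KarchmerRazWigderson1995]
#4 FormulaLayerLift (crux) — DECLARED RESIDUAL (S-implied, the honest gap between the KRW ladder and
the summit): if P is not contained in non-uniform NC¹ then P ≠ NP. [difficulty: open-problem] (why
it might fail: P = NP is consistent with P ⊄ NC¹/poly as far as anyone knows; composition is a
formula (tree) phenomenon and no dag-like composition theorem or NC¹-to-NP lift is in print — this
is the residual, not an attack.) [KarchmerRazWigderson1995, arXiv:1911.08297]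
#9 CompositionIteration (support) — Printed glue (KRW95 §5 Thm 7–8; Meir 2023 §1 "weak KRW ⇒ P ⊄
NC¹", folklore): the weak KRW conjecture in depth form with loss O(log mn) (inlined as the
hypothesis) yields a language in P outside non-uniform NC¹ — iterate h_{j+1} = h_j ⋄ g_{j+1} with
inner arity log N for ω(1) levels and read the protocol-depth bound through the easy direction of
Karchmer–Wigderson. [difficulty: L] [KarchmerRazWigderson1995, Meir2023, KarchmerWigderson1990]

TWO-LAYER PLAN. Foreseen glued splits once work starts (registered as birth skeletons, not filed as
items): StrongComposition ⇐ MuxToFunction (Meir Lemma 6)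
→ ResidualRectangle → ChromaticEndgame (Meir Lemma 8) → SteeredTranscript (the lever);
StandardFromStrong ⇐ HardwireStrong → MuxFromStandard
(Lemma 6, ⋄) → MuxConversion (the core, in the multiplexor world). CompositionIteration ⇐ KW easy
direction for `NC1` + the KRW95 iteration.

KILL CRITERIA. ¬StrongComposition by an explicit family (f, protocols for KW_f ⊛ KW_g of depth ≤
C(KW_f) + n − ω(log mn) for EVERY g) closes the route
`refuted:StrongComposition` (and refutes weak KRW's strong half — a result in itself).
¬StandardFromStrong (savings ω(log mn) at the ⋄-hardest
inner function) kills this line's passage to weak KRW: pivot to the fixed-g form for Meir's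
multiplexor-hard g, else close. A proof of
P ⊆ NC¹-hardness elsewhere (P ⊄ NC¹ landed) moots C1, C2, S3 and leaves only the residual R. R is
never attacked here.

NOT DECOMPOSED YET. The steering potential's exact bookkeeping (which child at label bits vs matrix
bits), the restricted-rectangle complexity measure, the
constants 5/6/12 of the skeleton, Meir's Lemma 6/8 formalisations (stubs of the birth skeletons),
the KW easy direction and the KRW95
iteration inside CompositionIteration — all layer-2 / prover-attached lemmas, not items.

CHEAPEST FALSIFIER. For StandardFromStrong: a literature/computation check whether the known
additive savings for composition (Sipser's ⊕₃ ⋄ ⊕₃, Pudlák's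
threshold-2 examples, hazard-free/KW savings) exceed O(log mn) in DEPTH for any family — all
recorded savings are O(1) or O(log log n)
additive (KRW95 §4; arXiv:2007.02740 pp.5–6), none growing; an exact brute force of max_g C(KW_f ⊛
KW_g) vs max_g C(KW_{f⋄g}) at m = n = 2
is one kit job (16×16 inputs). For StrongComposition: Meir's Prop 9 transcript — check by hand
whether its live label rectangles
(a, b at Hamming distance ≥ 0.3m inside f⁻¹(1) × f⁻¹(0), L(f) ≥ 2^m/m) still need depth ≈ C(KW_f);
if they are cheap the lever is dead.

NUMBERS. γ in print: > 0.04 (Meir2023 Thm 3.1, 24m/25 in the tree's `MeirStrongComposition`);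
averaging provably stuck below 0.64 (Meir2023 §7
Prop 9); needed: γ = 1 with additive loss c·(log₂(mn)+1). KRW needs loss < n/2 per level at n = log
N inner arity (KRW95 §5). Known KRW
cases: f ⋄ U (EIRS91/HW93/GMWW14), f ⋄ ⊕ (DinurMeir2016), U ⋄ MUX partial (Meir 2020, Wu 2023),
monotone lifted inner g (arXiv:2007.02740).
Items at open: 4 (3 cruxes incl. 1 residual, 1 support).

DEFINITION REQUESTS. None outstanding: `KWTree`, `Solves`, `blockComp`, `rowLabels`, `SolvesStrong`,
`compose`, `liftRows`, `MeirStrongComposition`,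
`DepthHardFunctionsExist` landed in Literature/Computability/Complexity/KRWComposition.lean
(p169508); `NC1`, `Classes.P` exist. The
partially-half-duplex machinery (Meir Def 15–19, characteristic graphs Def 22) is typed inside the
birth skeletons
(Cruxes/<Decl>/Lines/birth.lean) and is promoted to Literature only when a stub prover needs it
shared.

Novelty: Searches (2026-08-17): `lit search --hybrid "strong composition Karchmer Wigderson multiplexor
half-duplex lower bound"` (6; Jukna2012
pp.610/238, hazard-free KW arXiv:2107.05128 — no strong-composition hit beyond the held Meir2023);
`lit galaxy search "KRW conjecture|Karchmer-Raz-Wigderson"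
--star all` (8: HIMS18 ECCC TR18-089, Dementiev–Ignatiev–Sidelnik–Smal–Ushakov ECCC TR20-117,
hazard-free formulas arXiv:2411.09026,
ECCC TR23-174 image-only); `lit search "KRW conjecture" --source local` (8: arXiv:2007.02740,
DinurMeir2016, FilmusMeirTal ToC 2023,
arXiv:2012.02210, Cook–Mertz STOC 2024 TreeEval, arXiv:2001.02144, Hirahara 2023 meta-complexity);
`lit search --hybrid "natural proofs
barrier KRW composition conjecture formula depth"` (6, proof-complexity books only); `lean search
KWTree|SolvesStrong|Karchmer` over 59
PneNP Theses (0 hits outside Literature); `ledger negatives --problem PneNP` (6, none on protocols);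
plus the sketch's recorded frontier /
bridges / galaxy sweeps (SKETCH.md §Novelty, judged PASS).
Nearest prior art found: Meir2023 (arXiv:2306.00615: Thm 3.1 γ ≈ 0.04 by averaging; Lemma 6, Lemma
8; §7 Prop 9 the 0.64 ceiling of
averaging); MS21 / HIMS18 (phd model, multiplexor lower bounds); arXiv:2007.02740 (KRW for lifted
monotone inner functions, obstacle-1
discussion p.5); DinurMeir2016 (f ⋄ ⊕, information-complexity top-down method).
Delta: replaces Meir's averaging over inner functions by a χ-steered transcript walk (potential =
transcript length + restri  [refs: 2107.05128, 2411.09026, 2007.02740, 2012.02210, 2001.02144, 2306.00615, Jukna2012, Meir2023, DinurMeir2016]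

Barriers (technique_class: krw-composition, kw-rectangle-measures, de-morgan-depth): - technique_class: krw-composition, strong-composition, karchmer-wigderson-games,
kw-rectangle-measures, two-party-communication-complexity, top-down-formula-depth-lower-bounds,
de-morgan-formula-depth-lower-bounds, chromatic-number-potential-steering,
partially-half-duplex-protocols, multiplexor-lower-bounds
- Literature.Barriers.PneNP.NaturalProofs: outside as far as known — the property used ("KW_f ⊛ KW_g
/ KW_{f⋄g} needs depth ≥ C(KW_f) + n − O(log)" for the explicit iterated composition) is large but
not known to be constructive (formula-depth of a truth table is a Formula-MCSP instance); the KRW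
programme is the catalogue's own listed escape from the measure/restriction ceilings
(BarrierCatalogue "Escape: KRW composition conjecture via Karchmer–Wigderson relations"); the bet,
shared with KRW95/DinurMeir2016/Meir2023, is that top-down protocol arguments do not naturalize.
- Literature.Barriers.PneNP.Relativization: does not quantify over C1/C2/S3 (statements about
protocol trees for explicit finite games, no oracle machines); it bites only the residual R, which
is declared residual and not attacked.
- Literature.Barriers.PneNP.Algebrization: same placement as Relativization — outside for C1/C2/S3,
bites R only.
- Literature.Barriers.PneNP.KhrapchenkoLimit: outside — no rectangle measure of a single function is
used; the route multiplies LEVELS of composition (the catalogue lists KRW-via-KW-relations as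
evasion (ii) of this entry).
- Literature.Barriers.PneNP.SubmodularMe

sub-problem: PneNP · status: open · opened planner-type-731d09c9c5-0 2026-08-17T16:39:30Z · rev 4 · ledger route-PneNP-KrwChromaticSteering
GENERATED by the gate from the ledger (D-0016/17). Provers cite these decls: `theorem foo : Summit.PneNP.PneNP.Theses.KrwChromaticSteering.<Decl> := …` in Summits/PneNP/PneNP/Theorems/<Name>.lean.
-/

namespace Summit.PneNP.PneNP.Theses.KrwChromaticSteering

open scoped BigOperators Topology Manifold Classical MeasureTheory ProbabilityTheory Matrix InnerProductSpace ComplexConjugate ContinuousMap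
open Filter Set Function TopologicalSpace MeasureTheory

attribute [summit_statement] _root_.PneNP

open Literature.PNP

/-- item stmt-PneNP-18538 · crux · rank 2 · open · by planner
why it might fail: Meir §7 Prop 9: for L(f) ≥ 2^m/m, m ≥ 2n there is a protocol and a 0.64-live transcript with χ(G_π) = 1; if such transcripts can ALSO keep every live residual label rectangle cheap, no steering potential survives and γ = 1 is false for depth as typed.
sources: Meir2023, arXiv:2306.00615, KarchmerRazWigderson1995, DinurMeir2016
[crux] Strong composition with γ = 1 (card item C1): ∃ c ∀ m n ≥ 1 ∀ non-constant f : {0,1}^m →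
{0,1} ∃ g : {0,1}^n → {0,1} ∀ protocol tree P solving KW_f ⊛ KW_g ∃ tree Q solving KW_f with depth Q
+ n ≤ depth P + c·(⌊log₂(mn)⌋+1). [difficulty: XL] -/
@[route_item "route-PneNP-KrwChromaticSteering", crux]
def StrongComposition : Prop :=
  ∃ c : ℕ, ∀ m n : ℕ, 1 ≤ n → ∀ f : (Fin m → Bool) → Bool, (∃ a b, f a ≠ f b) → ∃ g : (Fin n → Bool) → Bool, ∀ P : Literature.Computability.Complexity.KWTree (Fin m × Fin n), P.SolvesStrong f g → ∃ Q : Literature.Computability.Complexity.KWTree (Fin m), Q.Solves f ∧ Q.depth + n ≤ P.depth + c * (Nat.log 2 (m * n) + 1)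

/-- item stmt-PneNP-18539 · crux · rank 3 · open · by planner
why it might fail: rows with a_i = b_i "might contain solutions as well" (dRMNPR20 p.5): a Sipser ⊕₃⋄⊕₃ / Pudlák T²ₙ-type saving that locates a differing entry in an equal-label row by hashing could grow to ω(log mn) at the ⋄-hardest g₀, refuting the comparison as typed.
sources: Meir2023, arXiv:2306.00615, arXiv:2007.02740, KarchmerRazWigderson1995
[crux] Meir's first obstacle, hardest-inner-function form (card item C2): ∃ c ∀ m, n ≥ 1 ∀
non-constant f ∃ g₀ ∀ g ∀ tree P solving KW_{f ⋄ g₀} ∃ tree P' solving KW_f ⊛ KW_g with depth P' ≤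
depth P + c·(⌊log₂(mn)⌋+1); equivalently max_g C(KW_f ⊛ KW_g) ≤ max_g C(KW_f ⋄ KW_g) + O(log mn),
i.e. CC^phd(KW_f ⊛ MUX_n) ≤ CC^phd(KW_f ⋄ MUX_n) + O(log mn). [difficulty: XL] -/
@[route_item "route-PneNP-KrwChromaticSteering", crux]
def StandardFromStrong : Prop :=
  ∃ c : ℕ, ∀ m n : ℕ, 1 ≤ n → ∀ f : (Fin m → Bool) → Bool, (∃ a b, f a ≠ f b) → ∃ g₀ : (Fin n → Bool) → Bool, ∀ g : (Fin n → Bool) → Bool, ∀ P : Literature.Computability.Complexity.KWTree (Fin m × Fin n), P.Solves (Literature.Computability.Complexity.blockComp f g₀) → ∃ P' : Literature.Computability.Complexity.KWTree (Fin m × Fin n), P'.SolvesStrong f g ∧ P'.depth ≤ P.depth + c * (Nat.log 2 (m * n) + 1)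

/-- item stmt-PneNP-18540 · crux · rank 4 · open · by planner
why it might fail: P = NP is consistent with P ⊄ NC¹/poly as far as anyone knows; composition is a formula (tree) phenomenon and no dag-like composition theorem or NC¹-to-NP lift is in print — this is the residual, not an attack.
sources: KarchmerRazWigderson1995, arXiv:1911.08297
[crux] DECLARED RESIDUAL (S-implied, the honest gap between the KRW ladder and the summit): if P is
not contained in non-uniform NC¹ then P ≠ NP. [difficulty: open-problem] -/
@[route_item "route-PneNP-KrwChromaticSteering", crux]
def FormulaLayerLift : Prop :=
  ¬ (Literature.Computability.Complexity.Classes.P ⊆ Literature.Computability.Complexity.NC1) → PneNP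

/-- item stmt-PneNP-18541 · crux (kind.auto-crux: conjecture-grade) · rank 9 · closed · proved by Summit.PneNP.PneNP.Theorems.CompositionIteration_proof (prover) · by planner
why it might fail: Only via print-to-tree mismatch (KW easy direction for the tree's B2/NC1 conventions: depth c·Nat.log 2 n + c, embedded negations; inner arity Θ(log N) over ω(1) levels); the printed implication weak-KRW ⇒ P ⊄ NC¹ (Meir 2023 Prop. 1, KRW95 §5) is not in doubt.
sources: arXiv:2306.00615, Meir2023, KarchmerRazWigderson1995, KarchmerWigderson1990
[support] Printed glue (KRW95 §5 Thm 7–8; Meir 2023 §1 "weak KRW ⇒ P ⊄ NC¹", folklore): the weak KRW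
conjecture in depth form with loss O(log mn) (inlined as the hypothesis) yields a language in P
outside non-uniform NC¹ — iterate h_{j+1} = h_j ⋄ g_{j+1} with inner arity log N for ω(1) levels and
read the protocol-depth bound through the easy direction of Karchmer–Wigderson. [difficulty: L] -/
@[route_item "route-PneNP-KrwChromaticSteering", crux]
def CompositionIteration : Prop :=
  (∃ c : ℕ, ∀ m n : ℕ, 1 ≤ n → ∀ f : (Fin m → Bool) → Bool, (∃ a b, f a ≠ f b) → ∃ g : (Fin n → Bool) → Bool, ∀ P : Literature.Computability.Complexity.KWTree (Fin m × Fin n), P.Solves (Literature.Computability.Complexity.blockComp f g) → ∃ Q : Literature.Computability.Complexity.KWTree (Fin m), Q.Solves f ∧ Q.depth + n ≤ P.depth + c * (Nat.log 2 (m * n) + 1)) → ∃ L ∈ Literature.Computability.Complexity.Classes.P, L ∉ Literature.Computability.Complexity.NC1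

-- `CompositionIteration` holds: proved by `Summit.PneNP.PneNP.Theorems.CompositionIteration_proof` (its module imports this route file, so no `_holds` link can be stated here).

/-- item stmt-PneNP-18542 · assembly · rank 1 · open · by planner
sources: KarchmerRazWigderson1995, Meir2023
[assembly] StrongComposition → StandardFromStrong → CompositionIteration → FormulaLayerLift → P ≠
NP. -/
@[route_item "route-PneNP-KrwChromaticSteering"]
def Assembly : Prop :=
  StrongComposition → StandardFromStrong → CompositionIteration → FormulaLayerLift → PneNP

/-! D-0027 §2.1 — DECIDING THEOREM (planner-authored via `route open/edit --closes-file`; by planner-type-731d09c9c5-0 2026-08-17T16:39:30Z):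
its hypotheses are this route's items and its conclusion the sub-problem Statement (glue_lint), and it elaborates with this file. -/

/-- The deciding theorem: strong composition with `γ = 1` (`StrongComposition`) and the
hardest-inner-function comparison (`StandardFromStrong`) give the weak KRW conjecture in depth
form (take the `g₀` of the comparison; a `KW_{f⋄g₀}` tree yields a `KW_f ⊛ KW_g` tree for the
`g` of strong composition at cost `c₂·L`, which yields a `KW_f` tree shorter by `n` at cost
`c₁·L`, `L = ⌊log₂(mn)⌋+1`); the printed iteration (`CompositionIteration`) turns weak KRW into
`P ⊄ NC¹`, and the declared residual (`FormulaLayerLift`) carries it to `P ≠ NP`. -/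
@[closes "route-PneNP-KrwChromaticSteering"] theorem closes (h1 : StrongComposition) (h2 : StandardFromStrong) (s3 : CompositionIteration)
    (hR : FormulaLayerLift) : PneNP := by
  have weakKRW :
      ∃ c : ℕ, ∀ m n : ℕ, 1 ≤ n → ∀ f : (Fin m → Bool) → Bool, (∃ a b, f a ≠ f b) →
        ∃ g : (Fin n → Bool) → Bool,
          ∀ P : Literature.Computability.Complexity.KWTree (Fin m × Fin n),
            P.Solves (Literature.Computability.Complexity.blockComp f g) →
              ∃ Q : Literature.Computability.Complexity.KWTree (Fin m),
                Q.Solves f ∧ Q.depth + n ≤ P.depth + c * (Nat.log 2 (m * n) + 1) := by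
    obtain ⟨c₁, h1⟩ := h1
    obtain ⟨c₂, h2⟩ := h2
    refine ⟨c₁ + c₂, fun m n hn f hf => ?_⟩
    obtain ⟨g, hg⟩ := h1 m n hn f hf
    obtain ⟨g₀, hg₀⟩ := h2 m n hn f hf
    refine ⟨g₀, fun P hP => ?_⟩
    obtain ⟨P', hP', hd'⟩ := hg₀ g P hP
    obtain ⟨Q, hQ, hd⟩ := hg P' hP'
    refine ⟨Q, hQ, ?_⟩
    have hsplit : (c₁ + c₂) * (Nat.log 2 (m * n) + 1)
        = c₁ * (Nat.log 2 (m * n) + 1) + c₂ * (Nat.log 2 (m * n) + 1) := by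
      ring
    omega
  refine hR fun hsub => ?_
  obtain ⟨L, hLP, hLNC⟩ := s3 weakKRW
  exact hLNC (hsub hLP)

end Summit.PneNP.PneNP.Theses.KrwChromaticSteering
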